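import Mathlib
import Summits.KontsevichZagierPeriods.Zeta5Search.BrickDigitStripMain
import Summits.KontsevichZagierPeriods.Zeta5Search.BrickDigitStripCarry
import Summits.KontsevichZagierPeriods.Zeta5Search.BrickDigitStripCirc

/-!
# BrickHatStrip — zi-p2's THEOREM 9 (i) HAT IDENTITY: for an OFF-DIGIT cell `K = jp + i` (`1 ≤ i ≤ p−1`) of the row
`np`, `F_K^{(np)}(pT) = a·F̃_j^{(n−1)}(T)·Ê_j(T)·U_K(T)` with the HAT FACTOR `Ê_j = (T − (j+n))^B(T + (2n−1−j))^B`
(so that `n^{A−2B}·Ê_j·F̃_j^{(n−1)} = F̂_j^{(n)}`, the Laurent series of the hat kernel `R̂_n = n^{A−2B}[(t−n)(t+2n−1)]^B·R̃_{n−1}`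
at `−j`), independently of the digit `i` (cell zeta5-irr)

HONEST FRAMING: systematic search; no irrationality claim unless certified. INSTRUMENT lemma of the ζ(5)
census cell zeta5-irr (HOME `run/shared/lean/pub/zeta5-irr/`; memo `zi-p2/probes/B8/thm9/THEOREM9.md` (sealed
eae326393abac726) §2 (i) «HAT IDENTITY (no level hypothesis). For every off-digit cell K = jp + i of the row np:
F_K^{(np)}(pT) = Λ_K·F̂_j^{(n)}(T)·U_K(T)», LEMMA 9.1 «the p-divisible distances, divided by p, are EXACTLY the distances
of the cell j of the HAT KERNEL R̂_n(t) := n!^{A−2B}(t−n)_n^B(t+n)_n^B/(t)_n^A … R̂_n = P(t)·R̃_{n−1}(t), P(t) :=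
n^{A−2B}[(t−n)(t+2n−1)]^B»). Nothing here is about ζ(5); no irrationality content; filing moves no rung. Filed by the
engine seat zi-eng (g9); the off-digit analogue of `BrickDigitStripCirc` (° cells): same unit-factor machinery
(`BrickDigitStrip.prod_split/prod_unit_eq/prod_div_eq`), hole-type offset families.

## The statements (`p` odd prime, row `np` with `n = m + 1`, cell `K = i + jp`, `1 ≤ i < p`, `j ≤ m`)

* `den_family_hat`: `∏_{t ≤ np, t ≠ K}(pX + (t − K)) = C(c)·[∏_{t ≤ m, t ≠ j}(X + (t − j))]·V` (members `t = i + t′p`,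
  `t′ ≠ j`: the denominator of `F̃_j^{(m)}` — the member `t′ = n` of a digit cell is ABSENT);
* `num_family_one_hat`: `∏_{t=1}^{np}(pX − (K+t)) = C(c)·[∏_{t=1}^{n}(X − (j+t))]·V` (`= F̃`-family × `(X − (j+n))`);
* `num_family_two_hat`: `∏_{t=1}^{np}(pX + (np+t−K)) = C(c)·[∏_{t=1}^{n}(X + (m+t−j))]·V` (`= F̃`-family × `(X + (2n−1−j))`);
* `hatPoly B m j := (X − (j+m+1))^B·(X + (2m+1−j))^B` (monic, `ℤ_(p)` roots) and **`laurentSeries_rescale_eq_hat`**: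
  `rescale_p(laurentSeries A B 1 (np) K) = C(a)·laurentSeries A B 0 m j·hatPoly·U`, `U(0) = 1`, `IsSlopeInt p (−1) 0 U`,
  `a·hatPoly(0)·laurent A B 0 m j 0 = laurent A B 1 (np) K 0` — THE SAME `F̃_j^{(m)}·hatPoly` FOR EVERY DIGIT `i`.
The valuation of `a` (`= p^A`·unit·`n^{A−2B}`, THEOREM 9 LEMMA 9.2 (i)) is the sequel file.
-/

namespace Summit.KontsevichZagierPeriods.Zeta5Search.BrickHatStrip

open Finset Nat Polynomial WithZero
open Summit.KontsevichZagierPeriods.Zeta5Search.BrickLaurent (expandAt laurentSeries laurent kerNum kerDenErase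
  constantCoeff_coe_taylor coe_comp_C_mul_X rescale_inv eval_kerDenErase_neg_ne_zero)
open Summit.KontsevichZagierPeriods.Zeta5Search.BrickLaurentValuation (taylor_kerNum taylor_kerDenErase)
open Summit.KontsevichZagierPeriods.Zeta5Search.ScaledSeries (IsSlopeInt isSlopeInt_mul isSlopeInt_pow)
open Summit.KontsevichZagierPeriods.Zeta5Search.BrickPhiCoeff (isSlopeInt_inv)
open Summit.KontsevichZagierPeriods.Zeta5Search.BrickDigitStrip (prod_split IsUnitPoly prod_unit_eq prod_div_eq
  padicValuation_intCast_eq_one_of centre_factor)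
open Summit.KontsevichZagierPeriods.Zeta5Search.BrickDigitStripCarry (prod_Icc_add_of_le_one)
open Summit.KontsevichZagierPeriods.Zeta5Search.BrickDigitStripCirc (isSlopeInt_X_add_C)
open Literature.NumberTheory.LFunctions (padicValuation_natCast_eq_one padicValuation_natCast_le_one)

noncomputable section

variable {p : ℕ} [Fact p.Prime]

/-! ## The three offset families of an off-digit cell -/

section families

variable {m j i : ℕ} (hi1 : 1 ≤ i) (hip : i < p) (hj : j ≤ m)
include hi1 hip hj

omit hj in
/-- DENOMINATORS of an off-digit cell: `∏_{t ≤ np, t ≠ K}(pX + (t − K)) = C(c)·[∏_{t′ ≤ m, t′ ≠ j}(X + (t′ − j))]·V`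
(`n = m+1`; members `t = i + t′p`, `t′ ≤ m`, `t′ ≠ j`). -/
theorem den_family_hat :
    ∃ V : ℚ[X], IsUnitPoly p V ∧ ∃ c : ℚ, c ≠ 0 ∧
      ∏ t ∈ (range ((m + 1) * p + 1)).erase (i + j * p), (C (p : ℚ) * X + C ((t : ℚ) - (i + j * p : ℕ))) =
        C c * (∏ t ∈ (range (m + 1)).erase j, (X + C ((t : ℚ) - j))) * V := by
  have hp : p.Prime := Fact.out
  have hp0 : 0 < p := hp.pos
  have hKmod : (i + j * p) % p = i := by rw [Nat.add_mul_mod_self_right, Nat.mod_eq_of_lt hip]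
  have hg : ∀ t ∈ (range (m + 1)).erase j,
      i + t * p ∈ (range ((m + 1) * p + 1)).erase (i + j * p) ∧ (i + t * p) % p = i := by
    intro t ht
    have ht' := mem_range.1 (mem_erase.1 ht).2
    have htj := (mem_erase.1 ht).1
    have h1 : t * p ≤ m * p := Nat.mul_le_mul_right _ (by omega)
    have h2 : (m + 1) * p = m * p + p := by ring
    refine ⟨mem_erase.2 ⟨fun h => htj (Nat.eq_of_mul_eq_mul_right hp0 (by omega)), mem_range.2 (by omega)⟩, ?_⟩
    rw [Nat.add_mul_mod_self_right, Nat.mod_eq_of_lt hip]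
  have hinj : Set.InjOn (fun t => i + t * p) ((range (m + 1)).erase j : Finset ℕ) :=
    fun t₁ _ t₂ _ h => Nat.eq_of_mul_eq_mul_right hp0 (by simpa using h)
  have hsurj : ∀ t ∈ (range ((m + 1) * p + 1)).erase (i + j * p), t % p = i → ∃ t' ∈ (range (m + 1)).erase j,
      i + t' * p = t := by
    intro t ht hmod
    have ht' := mem_range.1 (mem_erase.1 ht).2
    have htK := (mem_erase.1 ht).1
    have hdec : i + t / p * p = t := by
      have := Nat.mod_add_div t p; rw [hmod, mul_comm] at this; exact this
    refine ⟨t / p, mem_erase.2 ⟨fun h => htK (by rw [← hdec, h]), mem_range.2 ?_⟩, hdec⟩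
    by_contra hcon
    have h1 : (m + 1) * p ≤ t / p * p := Nat.mul_le_mul_right _ (by omega)
    omega
  rw [prod_split (fun t => i + t * p) (fun t => t % p = i) hg hinj hsurj]
  have hdivpart : ∏ t ∈ (range (m + 1)).erase j, (C (p : ℚ) * X + C (((i + t * p : ℕ) : ℚ) - (i + j * p : ℕ))) =
      C ((p : ℚ) ^ ((range (m + 1)).erase j).card) * ∏ t ∈ (range (m + 1)).erase j, (X + C ((t : ℚ) - j)) := by
    rw [← prod_div_eq]
    refine prod_congr rfl fun t _ => ?_
    congr 2; push_cast; ring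
  have hunit : ∀ t ∈ ((range ((m + 1) * p + 1)).erase (i + j * p)).filter (fun t => ¬ t % p = i),
      Rat.padicValuation p ((t : ℚ) - (i + j * p : ℕ)) = 1 := by
    intro t ht
    have ht' := (mem_filter.1 ht).2
    rw [show ((t : ℚ) - ((i + j * p : ℕ) : ℚ)) = (((t : ℤ) - (i + j * p : ℕ) : ℤ) : ℚ) by push_cast; ring]
    refine padicValuation_intCast_eq_one_of fun hdvd => ht' ?_
    have h1 : ((i + j * p : ℕ) : ℤ) % (p : ℤ) = (t : ℤ) % (p : ℤ) := Int.ModEq.eq (Int.modEq_iff_dvd.2 hdvd)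
    rw [← Int.natCast_mod, ← Int.natCast_mod, Nat.cast_inj, hKmod] at h1
    exact h1.symm
  obtain ⟨V, hV, hc, hVeq⟩ := prod_unit_eq hunit
  refine ⟨V, hV, (p : ℚ) ^ ((range (m + 1)).erase j).card *
    ∏ t ∈ ((range ((m + 1) * p + 1)).erase (i + j * p)).filter (fun t => ¬ t % p = i), ((t : ℚ) - (i + j * p : ℕ)),
    mul_ne_zero (pow_ne_zero _ (by exact_mod_cast hp.ne_zero)) hc, ?_⟩
  rw [hdivpart, hVeq, map_mul]
  ring

omit hj in
/-- NUMERATORS I of an off-digit cell: `∏_{t=1}^{np}(pX − (K+t)) = C(c)·[∏_{t′=1}^{n}(X − (j+t′))]·V` (`K + t = p(j+t′)` ↔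
`t = t′p − i`, `t′ = 1..n`). -/
theorem num_family_one_hat :
    ∃ V : ℚ[X], IsUnitPoly p V ∧ ∃ c : ℚ, c ≠ 0 ∧
      ∏ t ∈ Icc 1 ((m + 1) * p), (C (p : ℚ) * X + C (-(((i + j * p : ℕ) : ℚ) + t))) =
        C c * (∏ t ∈ Icc 1 (m + 1), (X + C (-((j : ℚ) + t)))) * V := by
  have hp : p.Prime := Fact.out
  have hp0 : 0 < p := hp.pos
  have hg : ∀ t ∈ Icc 1 (m + 1), t * p - i ∈ Icc 1 ((m + 1) * p) ∧ p ∣ (i + j * p) + (t * p - i) := by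
    intro t ht
    have ht' := mem_Icc.1 ht
    have hlo : p ≤ t * p := Nat.le_mul_of_pos_left p (by omega)
    have hhi : t * p ≤ (m + 1) * p := Nat.mul_le_mul_right _ ht'.2
    refine ⟨mem_Icc.2 ⟨by omega, by omega⟩, ⟨j + t, ?_⟩⟩
    have : p * (j + t) = j * p + t * p := by ring
    omega
  have hinj : Set.InjOn (fun t => t * p - i) (Icc 1 (m + 1) : Finset ℕ) := by
    intro t₁ ht₁ t₂ ht₂ h
    have h₁ : p ≤ t₁ * p := Nat.le_mul_of_pos_left p (by have := (mem_Icc.1 ht₁).1; omega)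
    have h₂ : p ≤ t₂ * p := Nat.le_mul_of_pos_left p (by have := (mem_Icc.1 ht₂).1; omega)
    exact Nat.eq_of_mul_eq_mul_right hp0 (by simp only at h; omega)
  have hsurj : ∀ t ∈ Icc 1 ((m + 1) * p), p ∣ (i + j * p) + t → ∃ t' ∈ Icc 1 (m + 1), t' * p - i = t := by
    intro t ht hdvd
    have ht' := mem_Icc.1 ht
    obtain ⟨q, hq⟩ := hdvd
    rw [mul_comm p q] at hq
    have hjq : j < q := by
      by_contra hcon
      have := Nat.mul_le_mul_right p (not_lt.1 hcon)
      omega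
    have hqm : q ≤ j + (m + 1) := by
      by_contra hcon
      have h2 := Nat.mul_le_mul_right p (show j + (m + 1) + 1 ≤ q by omega)
      have h3 : (j + (m + 1) + 1) * p = j * p + (m + 1) * p + p := by ring
      omega
    have hsub : (q - j) * p = q * p - j * p := Nat.sub_mul q j p
    refine ⟨q - j, mem_Icc.2 ⟨by omega, by omega⟩, ?_⟩
    show (q - j) * p - i = t
    omega
  rw [prod_split (fun t => t * p - i) (fun t => p ∣ (i + j * p) + t) hg hinj hsurj]
  have hdivpart : ∏ t ∈ Icc 1 (m + 1), (C (p : ℚ) * X + C (-(((i + j * p : ℕ) : ℚ) + ((t * p - i : ℕ) : ℚ)))) =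
      C ((p : ℚ) ^ (Icc 1 (m + 1)).card) * ∏ t ∈ Icc 1 (m + 1), (X + C (-((j : ℚ) + t))) := by
    rw [← prod_div_eq]
    refine prod_congr rfl fun t ht => ?_
    have hlo : i ≤ t * p := (Nat.le_mul_of_pos_left p (by have := (mem_Icc.1 ht).1; omega)).trans' hip.le
    congr 2; push_cast [hlo]; ring
  have hunit : ∀ t ∈ (Icc 1 ((m + 1) * p)).filter (fun t => ¬ p ∣ (i + j * p) + t),
      Rat.padicValuation p (-(((i + j * p : ℕ) : ℚ) + t)) = 1 := by
    intro t ht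
    rw [Valuation.map_neg, ← Nat.cast_add]
    exact padicValuation_natCast_eq_one (mem_filter.1 ht).2
  obtain ⟨V, hV, hc, hVeq⟩ := prod_unit_eq hunit
  refine ⟨V, hV, _, mul_ne_zero (pow_ne_zero ((Icc 1 (m + 1)).card) (by exact_mod_cast hp.ne_zero : (p : ℚ) ≠ 0)) hc, ?_⟩
  rw [hdivpart, hVeq, map_mul]
  ring

/-- NUMERATORS II of an off-digit cell: `∏_{t=1}^{np}(pX + (np+t−K)) = C(c)·[∏_{t″=1}^{n}(X + (m+t″−j))]·V`
(`np + t − K = p(m + t″ − j)` ↔ `t = i + (t″−1)p`, `t″ = 1..n`). -/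
theorem num_family_two_hat :
    ∃ V : ℚ[X], IsUnitPoly p V ∧ ∃ c : ℚ, c ≠ 0 ∧
      ∏ t ∈ Icc 1 ((m + 1) * p), (C (p : ℚ) * X + C ((((m + 1) * p : ℕ) : ℚ) + t - (i + j * p : ℕ))) =
        C c * (∏ t ∈ Icc 1 (m + 1), (X + C ((m : ℚ) + t - j))) * V := by
  have hp : p.Prime := Fact.out
  have hp0 : 0 < p := hp.pos
  have hjp : j * p ≤ m * p := Nat.mul_le_mul_right _ hj
  have e2 : (m + 1) * p = m * p + p := by ring
  have hg : ∀ t ∈ Icc 1 (m + 1), i + (t - 1) * p ∈ Icc 1 ((m + 1) * p) ∧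
      p ∣ ((m + 1) * p) + (i + (t - 1) * p) - (i + j * p) := by
    intro t ht
    have ht' := mem_Icc.1 ht
    have hhi : (t - 1) * p ≤ m * p := Nat.mul_le_mul_right _ (by omega)
    have e2 : (m + 1) * p = m * p + p := by ring
    refine ⟨mem_Icc.2 ⟨by omega, by omega⟩, ⟨m + t - j, ?_⟩⟩
    have e1 : p * (m + t - j) = (m + t) * p - j * p := by rw [mul_comm, Nat.sub_mul]
    have e3 : (m + t) * p = m * p + (t - 1) * p + p := by
      rw [show m + t = m + (t - 1) + 1 by omega]; ring
    omega
  have hinj : Set.InjOn (fun t => i + (t - 1) * p) (Icc 1 (m + 1) : Finset ℕ) := by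
    intro t₁ ht₁ t₂ ht₂ h
    have h₁ := (mem_Icc.1 ht₁).1
    have h₂ := (mem_Icc.1 ht₂).1
    have h' : (t₁ - 1) * p = (t₂ - 1) * p := by simp only at h; omega
    have := Nat.eq_of_mul_eq_mul_right hp0 h'
    omega
  have hsurj : ∀ t ∈ Icc 1 ((m + 1) * p), p ∣ ((m + 1) * p) + t - (i + j * p) →
      ∃ t' ∈ Icc 1 (m + 1), i + (t' - 1) * p = t := by
    intro t ht hdvd
    have ht' := mem_Icc.1 ht
    obtain ⟨q, hq⟩ := hdvd
    rw [mul_comm p q] at hq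
    have e2 : (m + 1) * p = m * p + p := by ring
    -- `t = i + (q − (m + 1 − j))·p`
    have hlo : m + 1 - j ≤ q := by
      by_contra hcon
      have h3 := Nat.mul_le_mul_right p (show q + 1 ≤ m + 1 - j by omega)
      have h4 : (q + 1) * p = q * p + p := by ring
      have h5 : (m + 1 - j) * p = m * p + p - j * p := by rw [Nat.sub_mul, e2]
      omega
    have hhi : q ≤ 2 * m + 1 - j := by
      by_contra hcon
      have h3 := Nat.mul_le_mul_right p (show 2 * m + 1 - j + 1 ≤ q by omega)
      have h4 : (2 * m + 1 - j + 1) * p = 2 * (m * p) + p - j * p + p := by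
        rw [add_mul, one_mul, Nat.sub_mul, add_mul, one_mul, mul_assoc]
      omega
    refine ⟨q - (m + 1 - j) + 1, mem_Icc.2 ⟨by omega, by omega⟩, ?_⟩
    show i + (q - (m + 1 - j) + 1 - 1) * p = t
    have hsub : (q - (m + 1 - j)) * p = q * p - (m + 1 - j) * p := Nat.sub_mul _ _ _
    have h5 : (m + 1 - j) * p = m * p + p - j * p := by rw [Nat.sub_mul, e2]
    have hle' : (m + 1 - j) * p ≤ q * p := Nat.mul_le_mul_right _ hlo
    rw [Nat.add_sub_cancel]
    omega
  rw [prod_split (fun t => i + (t - 1) * p) (fun t => p ∣ ((m + 1) * p) + t - (i + j * p)) hg hinj hsurj]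
  have hdivpart : ∏ t ∈ Icc 1 (m + 1),
      (C (p : ℚ) * X + C ((((m + 1) * p : ℕ) : ℚ) + ((i + (t - 1) * p : ℕ) : ℚ) - (i + j * p : ℕ))) =
      C ((p : ℚ) ^ (Icc 1 (m + 1)).card) * ∏ t ∈ Icc 1 (m + 1), (X + C ((m : ℚ) + t - j)) := by
    rw [← prod_div_eq]
    refine prod_congr rfl fun t ht => ?_
    have ht1 := (mem_Icc.1 ht).1
    congr 2; push_cast [ht1]; ring
  have hunit : ∀ t ∈ (Icc 1 ((m + 1) * p)).filter (fun t => ¬ p ∣ ((m + 1) * p) + t - (i + j * p)),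
      Rat.padicValuation p ((((m + 1) * p : ℕ) : ℚ) + t - (i + j * p : ℕ)) = 1 := by
    intro t ht
    have ht1 := (mem_Icc.1 (mem_filter.1 ht).1).1
    have hle : i + j * p ≤ (m + 1) * p + t := by nlinarith
    rw [← Nat.cast_add, ← Nat.cast_sub hle]
    exact padicValuation_natCast_eq_one (mem_filter.1 ht).2
  obtain ⟨V, hV, hc, hVeq⟩ := prod_unit_eq hunit
  refine ⟨V, hV, _, mul_ne_zero (pow_ne_zero ((Icc 1 (m + 1)).card) (by exact_mod_cast hp.ne_zero : (p : ℚ) ≠ 0)) hc, ?_⟩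
  rw [hdivpart, hVeq, map_mul]
  ring

end families

/-! ## The hat factor and the assembled identity -/

/-- **The hat factor** `Ê_j = (X − (j+n))^B·(X + (2n−1−j))^B ∈ ℚ[X]` (`n = m+1`): monic, so that
`n^{A−2B}·Ê_j·F̃_j^{(m)} = F̂_j^{(n)}` is the Laurent series at `−j` of zi-p2's hat kernel `R̂_n = P·R̃_{n−1}`,
`P(t) = n^{A−2B}[(t−n)(t+2n−1)]^B`. -/
def hatPoly (B m j : ℕ) : ℚ[X] :=
  (X + C (-((j : ℚ) + ((m + 1 : ℕ) : ℚ)))) ^ B * (X + C ((m : ℚ) + ((m + 1 : ℕ) : ℚ) - j)) ^ B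

/-- `Ê_j(0) ≠ 0` (`j ≤ m`). -/
theorem hatPoly_eval_zero_ne_zero (B : ℕ) {m j : ℕ} (hj : j ≤ m) : (hatPoly B m j).eval 0 ≠ 0 := by
  unfold hatPoly
  simp only [eval_mul, eval_pow, eval_add, eval_X, eval_C, zero_add]
  refine mul_ne_zero (pow_ne_zero _ ?_) (pow_ne_zero _ ?_)
  · rw [neg_ne_zero]; positivity
  · have : (j : ℚ) ≤ m := by exact_mod_cast hj
    push_cast; linarith

/-- `Ê_j ∈ ℤ[X]` coefficientwise: `IsSlopeInt p 0 0 Ê_j`. -/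
theorem isSlopeInt_hatPoly (B m j : ℕ) : IsSlopeInt p 0 0 ((hatPoly B m j : ℚ[X]) : PowerSeries ℚ) := by
  unfold hatPoly
  rw [Polynomial.coe_mul, Polynomial.coe_pow, Polynomial.coe_pow]
  have ha : IsSlopeInt p 0 0 (((X + C (-((j : ℚ) + ((m + 1 : ℕ) : ℚ))) : ℚ[X]) : PowerSeries ℚ)) := by
    refine isSlopeInt_X_add_C ?_
    rw [Valuation.map_neg, ← Nat.cast_add]; exact padicValuation_natCast_le_one _
  have hb : IsSlopeInt p 0 0 (((X + C ((m : ℚ) + ((m + 1 : ℕ) : ℚ) - j)) : ℚ[X]) : PowerSeries ℚ) := by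
    refine isSlopeInt_X_add_C ?_
    rw [show (m : ℚ) + ((m + 1 : ℕ) : ℚ) - j = (((m : ℤ) + (m + 1 : ℕ) - j : ℤ) : ℚ) by push_cast; ring,
      Rat.padicValuation_cast]
    exact Int.padicValuation_le_one _ _
  have h := isSlopeInt_mul (isSlopeInt_pow ha B) (isSlopeInt_pow hb B)
  simpa using h

section hat

variable (hp2 : p ≠ 2) {A B m j i : ℕ} (hi1 : 1 ≤ i) (hip : i < p) (hj : j ≤ m)
include hp2 hi1 hip hj

/-- NUMERATOR of an off-digit cell: `taylor_{−K}(kerNum^{1}_{np})(pX) = C(a)·taylor_{−j}(kerNum^{0}_m)·Ê_j·V`, `V` unit,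
`a ≠ 0` (the centre offset `np/2 − K` is a `p`-adic unit). -/
theorem num_comp_eq_hat :
    ∃ V : ℚ[X], IsUnitPoly p V ∧ ∃ a : ℚ, a ≠ 0 ∧
      (taylor (-((i + j * p : ℕ) : ℚ)) (kerNum A B 1 ((m + 1) * p))).comp (C (p : ℚ) * X) =
        C a * taylor (-(j : ℚ)) (kerNum A B 0 m) * hatPoly B m j * V := by
  have hp : p.Prime := Fact.out
  have hcen : ¬ (p : ℤ) ∣ (((m + 1) * p : ℕ) : ℤ) - 2 * (i + j * p : ℕ) := by
    rintro ⟨c, hc⟩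
    have h2i : (p : ℤ) ∣ 2 * (i : ℤ) := ⟨(m + 1 : ℤ) - 2 * j - c, by push_cast at hc ⊢; linarith⟩
    have hpi : (p : ℤ) ∣ (i : ℤ) := by
      refine (Int.Prime.dvd_mul' hp h2i).resolve_left fun h => hp2 ?_
      exact (Nat.prime_dvd_prime_iff_eq hp Nat.prime_two).1 (by exact_mod_cast h)
    have hpi' : p ∣ i := by exact_mod_cast hpi
    have hle : p ≤ i := Nat.le_of_dvd (by omega) hpi'
    omega
  obtain ⟨Vc, hVc, cc, hcc, hceq⟩ := centre_factor (p := p) hp2 (ε := 1) (n := (m + 1) * p) (j := i + j * p) (Or.inr hcen)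
  obtain ⟨V₁, hV₁, c₁, hc₁, h₁⟩ := num_family_one_hat (p := p) (m := m) (j := j) hi1 hip
  obtain ⟨V₂, hV₂, c₂, hc₂, h₂⟩ := num_family_two_hat (p := p) hi1 hip hj
  rw [Finset.prod_Icc_succ_top (by omega)] at h₁ h₂
  obtain ⟨Ya, hYa⟩ : ∃ Y : ℚ[X], (X + C (-((j : ℚ) + ((m + 1 : ℕ) : ℚ))) : ℚ[X]) = Y := ⟨_, rfl⟩
  obtain ⟨Yb, hYb⟩ : ∃ Y : ℚ[X], (X + C ((m : ℚ) + ((m + 1 : ℕ) : ℚ) - j) : ℚ[X]) = Y := ⟨_, rfl⟩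
  rw [hYa] at h₁
  rw [hYb] at h₂
  set P₁ : ℚ[X] := ∏ t ∈ Icc 1 m, (X + C (-((j : ℚ) + t))) with hP₁
  set P₂ : ℚ[X] := ∏ t ∈ Icc 1 m, (X + C ((m : ℚ) + t - j)) with hP₂
  have hNf : ((m ! : ℚ)) ^ (A - 2 * B) ≠ 0 := pow_ne_zero _ (by positivity)
  have hnf : ((((m + 1) * p)! : ℚ)) ^ (A - 2 * B) ≠ 0 := pow_ne_zero _ (by positivity)
  set a : ℚ := ((((m + 1) * p)! : ℚ)) ^ (A - 2 * B) * cc * c₁ ^ B * c₂ ^ B / ((m ! : ℚ)) ^ (A - 2 * B) with ha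
  have key : C (((((m + 1) * p)! : ℚ)) ^ (A - 2 * B)) * C cc * C c₁ ^ B * C c₂ ^ B = C a * C (((m ! : ℚ)) ^ (A - 2 * B)) := by
    rw [← map_pow, ← map_pow, ← map_mul, ← map_mul, ← map_mul, ← map_mul, ha, div_mul_cancel₀ _ hNf]
  refine ⟨Vc * (V₁ ^ B * V₂ ^ B), hVc.mul ((hV₁.pow B).mul (hV₂.pow B)), a,
    div_ne_zero (mul_ne_zero (mul_ne_zero (mul_ne_zero hnf hcc) (pow_ne_zero _ hc₁)) (pow_ne_zero _ hc₂)) hNf, ?_⟩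
  rw [taylor_kerNum, taylor_kerNum]
  simp only [mul_comp, pow_comp, Polynomial.prod_comp, add_comp, X_comp, C_comp]
  rw [hceq, h₁, h₂, pow_zero, mul_one]
  unfold hatPoly
  rw [hYa, hYb]
  linear_combination (Vc * V₁ ^ B * V₂ ^ B * P₁ ^ B * P₂ ^ B * Ya ^ B * Yb ^ B) * key

/-- **THEOREM 9 (i), THE HAT IDENTITY**: for the off-digit cell `K = i + jp` (`1 ≤ i < p`, `j ≤ m`) of the row
`np = (m+1)p` of the full kernel: `rescale_p(F_K) = C(a)·F̃_j^{(m)}·Ê_j·U` with `U(0) = 1`, `[T^g]U ∈ p^gℤ_(p)`, and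
`a·Ê_j(0)·c̃_{j,A}(m) = c_{K,A}(np)` — the factor `F̃_j^{(m)}·Ê_j` does not depend on the digit `i`. -/
theorem laurentSeries_rescale_eq_hat :
    ∃ U : PowerSeries ℚ, PowerSeries.constantCoeff U = 1 ∧ IsSlopeInt p (-1) 0 U ∧ ∃ a : ℚ,
      PowerSeries.rescale (p : ℚ) (laurentSeries A B 1 ((m + 1) * p) (i + j * p)) =
        PowerSeries.C a * laurentSeries A B 0 m j * ((hatPoly B m j : ℚ[X]) : PowerSeries ℚ) * U ∧
      a * (hatPoly B m j).eval 0 * laurent A B 0 m j 0 = laurent A B 1 ((m + 1) * p) (i + j * p) 0 := by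
  obtain ⟨V₁, hV₁, a, ha, hN⟩ := num_comp_eq_hat (p := p) hp2 (A := A) (B := B) hi1 hip hj
  obtain ⟨V₂, hV₂, b, hb, hD⟩ := den_family_hat (p := p) (m := m) (j := j) hi1 hip
  -- the denominator with the `A`-th power
  have hD' : (taylor (-((i + j * p : ℕ) : ℚ)) (kerDenErase A ((m + 1) * p) (i + j * p))).comp (C (p : ℚ) * X) =
      C (b ^ A) * taylor (-(j : ℚ)) (kerDenErase A m j) * V₂ ^ A := by
    rw [taylor_kerDenErase, taylor_kerDenErase, pow_comp, Polynomial.prod_comp]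
    simp only [add_comp, X_comp, C_comp]
    rw [hD, mul_pow, mul_pow, map_pow]
  have hV₁0 : PowerSeries.constantCoeff (V₁ : PowerSeries ℚ) = 1 := by
    rw [Polynomial.constantCoeff_coe, coeff_zero_eq_eval_zero, hV₁.1]
  have hV₂0 : PowerSeries.constantCoeff ((V₂ ^ A : ℚ[X]) : PowerSeries ℚ) = 1 := by
    rw [Polynomial.constantCoeff_coe, coeff_zero_eq_eval_zero, (hV₂.pow A).1]
  have hU0 : PowerSeries.constantCoeff ((V₁ : PowerSeries ℚ) * (((V₂ ^ A : ℚ[X]) : PowerSeries ℚ))⁻¹) = 1 := by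
    rw [map_mul, PowerSeries.constantCoeff_inv, hV₁0, hV₂0, inv_one, mul_one]
  have hUint : IsSlopeInt p (-1) 0 ((V₁ : PowerSeries ℚ) * (((V₂ ^ A : ℚ[X]) : PowerSeries ℚ))⁻¹) := by
    have h := isSlopeInt_mul hV₁.2 (isSlopeInt_inv (hV₂.pow A).2 (by rw [hV₂0, map_one]))
    rwa [add_zero] at h
  have hbA : b ^ A ≠ 0 := pow_ne_zero _ hb
  have hid : PowerSeries.rescale (p : ℚ) (laurentSeries A B 1 ((m + 1) * p) (i + j * p)) =
      PowerSeries.C (a / b ^ A) * laurentSeries A B 0 m j * ((hatPoly B m j : ℚ[X]) : PowerSeries ℚ) *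
        ((V₁ : PowerSeries ℚ) * (((V₂ ^ A : ℚ[X]) : PowerSeries ℚ))⁻¹) := by
    have hL : PowerSeries.rescale (p : ℚ) (laurentSeries A B 1 ((m + 1) * p) (i + j * p)) =
        (((taylor (-((i + j * p : ℕ) : ℚ)) (kerNum A B 1 ((m + 1) * p))).comp (C (p : ℚ) * X) : ℚ[X]) :
          PowerSeries ℚ) *
        ((((taylor (-((i + j * p : ℕ) : ℚ)) (kerDenErase A ((m + 1) * p) (i + j * p))).comp (C (p : ℚ) * X) :
          ℚ[X]) : PowerSeries ℚ))⁻¹ := by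
      rw [laurentSeries, expandAt, map_mul, rescale_inv _ (by
        rw [constantCoeff_coe_taylor]; exact eval_kerDenErase_neg_ne_zero _ _ _), coe_comp_C_mul_X, coe_comp_C_mul_X]
    rw [hL, hN, hD', laurentSeries, expandAt]
    simp only [Polynomial.coe_mul, Polynomial.coe_C, PowerSeries.mul_inv_rev, PowerSeries.C_inv]
    rw [div_eq_mul_inv, map_mul]
    ring
  refine ⟨_, hU0, hUint, a / b ^ A, hid, ?_⟩
  have h0 := congrArg (PowerSeries.coeff 0) hid
  rw [PowerSeries.coeff_rescale, pow_zero, one_mul, mul_assoc, mul_assoc, PowerSeries.coeff_C_mul,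
    PowerSeries.coeff_zero_eq_constantCoeff_apply (laurentSeries A B 0 m j * _), map_mul, map_mul, hU0, mul_one,
    Polynomial.constantCoeff_coe, coeff_zero_eq_eval_zero, ← PowerSeries.coeff_zero_eq_constantCoeff_apply] at h0
  rw [laurent, laurent, h0]
  ring

end hat

end

end Summit.KontsevichZagierPeriods.Zeta5Search.BrickHatStrip
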